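import Literature.NumberTheory.FaltingsSerre.ParamodularCitedInstances
import Literature.NumberTheory.FaltingsSerre.Paramodular277Cited
import HarnessLib

/-!
# The residual identification datum from the KERNEL identification and Frobenius / inertia data

[BPPTVY] = A. Brumer, A. Pacetti, C. Poor, G. Tornaría, J. Voight, D. S. Yuen, *On the paramodularity of
typical abelian surfaces*, Algebra & Number Theory **13**:5 (2019) 1145–1195 [cite: BrumerEtAl2019]
(printed numbering and pages).  Step 1 of [Alg 2.4.1 p. 1155] as [Lemma 7.1.4 p. 1187] (`N = 277`),
[Thm 7.2.1 pp. 1189–1190] (`N = 353`) and [Thm 7.3.1 p. 1191] (`N = 587`) carry it out has TWO parts: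
(F) FIELD IDENTIFICATION — the fixed field of `ker ρ̄_f` is unramified outside `2N` with
`ord_N(d) ≤ 1` [Lemma 4.3.10 p. 1172 / Prop 5.2.4 p. 1175], its Frobenius data are constrained by
`Q_p(f,T) mod 2` [pp. 1187–1189: `det(1 − ρ̄_f(Frob₃)T) ∈ 𝔽₂[T]`, `L₃(A,T) mod 2`], and "a Hunter search, or looking up the possible fields in the database of
Jones and Roberts [2014]" leaves exactly one Galois closure, which is `ℚ(A[2])` [p. 1188: "exactly two
polynomials of degree 5 … Both polynomials have the same Galois closure"; p. 1190: "we find exactly two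
candidates … so we have the latter"]; (R) RIGIDITY — the residual representation with that kernel field
and those Frobenius data is determined up to conjugacy inside `Sp₄(𝔽₂) = ι(S₆)` [p. 1188: "we need to
distinguish the representations afforded by the inclusion `S₅ ⊆ S₆` and the fixed representation (5.1.1).
We refer to (5.1.8)"; p. 1190: "two embeddings of `S₃ ≀ C₂` into `GSp₄(𝔽₂)` up to inner automorphisms,
and they differ in the trace of order 3 and 6 elements"; (5.1.8) p. 1174].

WHAT THIS FILE DOES (cell record `DIVERGENCE.md` D-30).  The cited-form template
`paramodular_of_galoisCertificate_cited` (`ParamodularCited.lean`, D-29) takes Step 1 as ONE binder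
`hres : ResidualIdentification N af bf ρA` ("every admissible `σ̄` is `ι(S₆)`-conjugate to `ρ̄_A`").
Here part (R) is moved INTO THE KERNEL: `ResidualIdentification` follows from the strictly smaller datum
`KernelIdentification N af bf ρA` ("every admissible `σ̄` has the same kernel as `ρ̄_A`" = part (F), the
only table-dependent input) together with Frobenius / inertia data of `A` alone, by the tree's rigidity
theorems (`ResidualRigidity.lean`, `ResidualRigidityS3wrS2.lean`, D-20):
* `ResidualIdentification.of_kernel_of_transvection` — Route T (images `S₅(b)`, `S₆`): an element `c`
  with `ρ̄_A(c)` of order `5` (a good odd `q` with `a_q(A)`, `b_q(A)` odd: `charpoly = Φ₅ mod 2`,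
  `exists_orderFive_of_eulerData`) and ONE inertia element `τ` above `N` with `ρ̄_A(τ)` a transvection
  (inertia at `N ∥ cond` in `ℚ(A[2])` generated by a transposition [proof of Prop 5.2.4 p. 1175]); the
  admissible `σ̄` is then a transvection at the same `τ` by its inertia clause and the common kernel;
* `ResidualIdentification.of_kernel_of_range_eq` — image `S₆` (`im ρ̄_A = ι(S₆)`): one good odd
  `q ∤ N` with `a_q` even, `b_q` odd on both sides gives `u = Frob_q²` of order `3` with equal traces
  [(5.1.8)], excluding the outer automorphism of `S₆`;
* `ResidualIdentification.of_kernel_of_range_S3wrS2` — image `S₃ ≀ S₂` (`N = 353`): the same `q` gives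
  `u = Frob_q` of order `3` or `6` with equal traces [p. 1190].
The mixed Frobenius computation (`ρ̄_A` reduced from `ℤ₂`, `σ̄` over `𝔽₂`) is
`exists_frob_charpoly_eq_of_parity`.  Instances: `Paramodular277.paramodular_277_cited_of_kernel`
(`q = 3`: `L₃(A₂₇₇) = 1 + T + T² + 3T³ + 9T⁴`, `(a₃, b₃) = (−1, 1)` odd/odd [(6.2.4) p. 1179: `Q₃(f₂₇₇)`; Lemma 7.1.4 (proof) pp. 1187–1188: `det(1 − ρ̄_f(Frob₃)T) = Φ₅`]),
`Paramodular349.paramodular_349_cited_of_kernel` (`(a₃, b₃) = (−1, −1)`; NOT a printed theorem, see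
`ParamodularCitedInstances.lean`), `Paramodular353.paramodular_353_cited_of_kernel` (`q = 11`:
`L₁₁(A₃₅₃) = Q₁₁(f₃₅₃) = 1 − 2T + T² − 22T³ + 121T⁴` [(7.2.2) p. 1189], `(a₁₁, b₁₁) = (2, 1)` even/odd),
`Paramodular587plus.paramodular_587plus_cited_of_kernel` (`q = 3`, `(a₃, b₃)(A⁺) = (0, 1)`; the plus pair is
NOT treated in print, see `Paramodular587plusCore.lean`).  In each, the binder `hres` of the D-29 instance
is REPLACED by `hK : KernelIdentification N af bf ρA` plus: (277/349) `hi` (a transvection in `ρ̄_A` of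
inertia above `N`) and `b₃(A)`; (353) the image hypothesis `h₁` (`im ρ̄_A` = a conjugate of `ι(S₃ ≀ S₂)`)
and `b₁₁(A)`, `(a₁₁, b₁₁)(f)`; (587⁺) nothing new (`#im ρ̄_{A₅₈₇} = 720` was already a binder).
`KernelIdentification` is, like `ResidualIdentification`, a property of `ρ̄_A` and integers attested by
the certificate's `residual` block (candidate-field enumeration ×2 + exclusions) — never a Literature
fact; whether the Jones–Roberts completeness claim behind it is accepted is the referee's standing
question (cell `REFEREE.md`), now isolated from the rigidity part, which is a theorem here.
-/

noncomputable section

namespace Literature.NumberTheory.FaltingsSerre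

open Polynomial IsDedekindDomain Field Equiv
open Literature.NumberTheory.GaloisRepresentations Literature.NumberTheory.FaltingsSerre.GSp4F2
  Literature.NumberTheory.Automorphic.Paramodular Literature.NumberTheory.Automorphic
  Literature.AlgebraicGeometry.Motives
open scoped NumberField

/-- **The kernel identification datum** of level `N` for the form-side Euler data `(a_p, b_p)_p` and the
curve-side representation `ρA` — part (F) of Step 1: every continuous `σ̄ : Gal_ℚ → GL₄(𝔽₂)` with
values in `ι(S₆) = Sp₄(𝔽₂)`, unramified at the finite places `v ∤ 2N`, with
`charpoly σ̄(Frob_p) = X⁴Q_p(f)(1/X) mod 2` at the primes `p ∤ 2N`, and whose inertia above `N` acts through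
`1` or transvections, has the SAME KERNEL as `ρ̄_A = residual ρA` (the fixed field of `ker σ̄` is
`ℚ(A[2])`: the candidate-field enumeration "unramified outside `2N`, `ord_N(d) ≤ 1`, Frobenius data
`mod 2`" leaves one Galois closure).  Same four hypotheses as `ResidualIdentification`, weaker conclusion.
A property of `ρ̄_A` and integers, attested by the certificate's `residual` block; never a Literature
fact. [cite: BrumerEtAl2019, Lemma 7.1.4 pp. 1187–1188; Thm 7.2.1 pp. 1189–1190; Lemma 4.3.10 p. 1172; Prop 5.2.4 p. 1175] -/
def KernelIdentification (N : ℕ) (a b : ℕ → ℤ) (ρA : FramedGaloisRep ℚ ℤ_[2] 4) : Prop :=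
  ∀ σ : FramedGaloisRep ℚ (ZMod 2) 4,
    (∀ γ, σ γ ∈ iotaGL.range) →
    (∀ v : HeightOneSpectrum (𝓞 ℚ), ((2 : ℕ) : 𝓞 ℚ) ∉ v.asIdeal → ((N : ℕ) : 𝓞 ℚ) ∉ v.asIdeal →
      σ.IsUnramifiedAt v) →
    (∀ p : ℕ, p.Prime → ¬ p ∣ N → p ≠ 2 →
      ∀ v : HeightOneSpectrum (𝓞 ℚ), ((p : ℕ) : 𝓞 ℚ) ∈ v.asIdeal →
        σ.HasFrobCharpolyAt v ((lPolynomialOfSurface p (a p) (b p)).reverse.map (Int.castRingHom (ZMod 2)))) →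
    (∀ v : HeightOneSpectrum (𝓞 ℚ), ((N : ℕ) : 𝓞 ℚ) ∈ v.asIdeal →
      ∀ 𝔓 ∈ v.primesAbove, ∀ τ ∈ 𝔓.inertia (absoluteGaloisGroup ℚ),
        σ τ = 1 ∨ IsTransvection ((σ τ : GL (Fin 4) (ZMod 2)) : Matrix (Fin 4) (Fin 4) (ZMod 2))) →
    ∀ γ, residual ρA.toMonoidHom γ = 1 ↔ σ γ = 1

/-- The residual identification datum implies the kernel identification datum (conjugate
homomorphisms have the same kernel). [cite: BrumerEtAl2019, Lemma 7.1.4 p. 1187] -/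
theorem ResidualIdentification.kernelIdentification {N : ℕ} {a b : ℕ → ℤ}
    {ρA : FramedGaloisRep ℚ ℤ_[2] 4} (h : ResidualIdentification N a b ρA) :
    KernelIdentification N a b ρA := by
  intro σ hSp hunr hchar hin γ
  obtain ⟨π, hπ⟩ := h σ hSp hunr hchar hin
  rw [hπ γ]
  constructor
  · intro h1
    rw [h1, mul_one, mul_inv_cancel]
  · intro h1
    have h2 : residual ρA.toMonoidHom γ = (iotaGL π)⁻¹ * (iotaGL π * residual ρA.toMonoidHom γ *
        (iotaGL π)⁻¹) * iotaGL π := by group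
    rw [h2, h1]
    group

section Frobenius

/-- `X⁴L(1/X)` read directly in `𝔽₂[X]` (`a` even, `b` odd, `q` odd): `X⁴ + X² + 1`.
[cite: BrumerEtAl2019, Thm 7.2.1 (proof) p. 1189: "`L₁₁(A,T) ≡ 1 + T² + T⁴`"] -/
theorem map_reverse_lPolynomialOfSurface_zmod_two_of_parity {q : ℕ} (hq : Odd q) {a b : ℤ}
    (ha : Even a) (hb : Odd b) :
    (lPolynomialOfSurface q a b).reverse.map (Int.castRingHom (ZMod 2)) = X ^ 4 + X ^ 2 + 1 := by
  rw [show Int.castRingHom (ZMod 2) = (PadicInt.toZMod (p := 2)).comp (Int.castRingHom ℤ_[2]) from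
    RingHom.ext_int _ _, ← Polynomial.map_map, map_reverse_lPolynomialOfSurface_of_parity hq ha hb]

/-- **The mixed Frobenius computation.**  `ρA` (over `ℤ₂`) with Frobenius polynomial `X⁴L_q(1/X)`,
`(a', c')` even/odd, and `σ̄` (over `𝔽₂`) with Frobenius polynomial `X⁴Q_q(1/X) mod 2`, `(a, c)`
even/odd, at the places over one odd prime `q`: some arithmetic Frobenius `φ` has
`charpoly ρ̄_A(φ) = charpoly σ̄(φ) = X⁴ + X² + 1`. [cite: BrumerEtAl2019, Thm 7.2.1 (proof) p. 1189; (5.1.8) p. 1174] -/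
theorem exists_frob_charpoly_eq_of_parity {ρA : FramedGaloisRep ℚ ℤ_[2] 4}
    {σ : FramedGaloisRep ℚ (ZMod 2) 4} {q : ℕ} (hq : q.Prime) (hq2 : q ≠ 2) {a' c' a c : ℤ}
    (hAq : ∀ v : HeightOneSpectrum (𝓞 ℚ), ((q : ℕ) : 𝓞 ℚ) ∈ v.asIdeal →
      ρA.HasFrobCharpolyAt v ((lPolynomialOfSurface q a' c').reverse.map (Int.castRingHom ℤ_[2])))
    (hσq : ∀ v : HeightOneSpectrum (𝓞 ℚ), ((q : ℕ) : 𝓞 ℚ) ∈ v.asIdeal →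
      σ.HasFrobCharpolyAt v ((lPolynomialOfSurface q a c).reverse.map (Int.castRingHom (ZMod 2))))
    (ha' : Even a') (hc' : Odd c') (ha : Even a) (hc : Odd c) :
    ∃ φ : absoluteGaloisGroup ℚ,
      ((residual ρA.toMonoidHom φ : GL (Fin 4) (ZMod 2)) : Matrix (Fin 4) (Fin 4) (ZMod 2)).charpoly =
          X ^ 4 + X ^ 2 + 1 ∧
        ((σ φ : GL (Fin 4) (ZMod 2)) : Matrix (Fin 4) (Fin 4) (ZMod 2)).charpoly = X ^ 4 + X ^ 2 + 1 := by
  have hqo : Odd q := hq.odd_of_ne_two hq2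
  obtain ⟨v, 𝔓, h𝔓, φ, hv, hφ⟩ := exists_arithFrob q hq
  have hr := charpoly_residual_of_hasFrobCharpolyAt (hAq v hv) h𝔓 hφ
  rw [map_reverse_lPolynomialOfSurface_of_parity hqo ha' hc'] at hr
  have hr' : ((σ φ : GL (Fin 4) (ZMod 2)) : Matrix (Fin 4) (Fin 4) (ZMod 2)).charpoly =
      (lPolynomialOfSurface q a c).reverse.map (Int.castRingHom (ZMod 2)) := hσq v hv 𝔓 h𝔓 φ hφ
  rw [map_reverse_lPolynomialOfSurface_zmod_two_of_parity hqo ha hc] at hr'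
  exact ⟨φ, hr, hr'⟩

/-- From `charpoly g = charpoly h = X⁴ + X² + 1` over `𝔽₂`: `g⁶ = 1`, `g² ≠ 1`, `tr g = tr h`, and
`(g²)³ = 1`, `tr g² = tr h²` (Cayley–Hamilton; `tr(x²) = tr(x)` over `𝔽₂`). [folklore] -/
theorem GSp4F2.orderSix_datum_of_charpoly {g h : GL (Fin 4) (ZMod 2)}
    (hg : (g : Matrix (Fin 4) (Fin 4) (ZMod 2)).charpoly = X ^ 4 + X ^ 2 + 1)
    (hh : (h : Matrix (Fin 4) (Fin 4) (ZMod 2)).charpoly = X ^ 4 + X ^ 2 + 1) :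
    g ^ 6 = 1 ∧ g ^ 2 ≠ 1 ∧
      Matrix.trace (g : Matrix (Fin 4) (Fin 4) (ZMod 2)) = Matrix.trace (h : Matrix (Fin 4) (Fin 4) (ZMod 2)) ∧
      (g ^ 2) ^ 3 = 1 ∧
      Matrix.trace ((g ^ 2 : GL (Fin 4) (ZMod 2)) : Matrix (Fin 4) (Fin 4) (ZMod 2)) =
        Matrix.trace ((h ^ 2 : GL (Fin 4) (ZMod 2)) : Matrix (Fin 4) (Fin 4) (ZMod 2)) := by
  obtain ⟨h6, h2⟩ := GSp4F2.pow_six_eq_one_of_charpoly hg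
  have h6' : g ^ 6 = 1 := Units.ext (by rw [Units.val_pow_eq_pow_val, Units.val_one]; exact h6)
  refine ⟨h6', fun h1 => h2 (by rw [← Units.val_pow_eq_pow_val, h1, Units.val_one]), ?_, ?_, ?_⟩
  · rw [Matrix.trace_eq_neg_charpoly_coeff, Matrix.trace_eq_neg_charpoly_coeff, hg, hh]
  · rw [← pow_mul]; exact h6'
  · rw [Units.val_pow_eq_pow_val, Units.val_pow_eq_pow_val, GSp4F2.trace_sq, GSp4F2.trace_sq,
      Matrix.trace_eq_neg_charpoly_coeff, Matrix.trace_eq_neg_charpoly_coeff, hg, hh]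

end Frobenius

section Generic

variable {N : ℕ} {a b : ℕ → ℤ} {ρA ρA' : FramedGaloisRep ℚ ℤ_[2] 4}

/-- **Route T** [images `S₅(b)` / `S₆`]: the residual identification datum from the kernel
identification datum, an element `c` with `ρ̄_A(c)` of order `5`, and one inertia element `τ` above `N`
at which `ρ̄_A(τ)` is a transvection — the admissible `σ̄` is a transvection at the same `τ` (its
inertia clause: `σ̄(τ) = 1` would force `ρ̄_A(τ) = 1` by the common kernel), and
`exists_conj_of_ker_iff_of_transvection` concludes. [cite: BrumerEtAl2019, Lemma 7.1.4 pp. 1187–1188; (5.1.8) p. 1174; Prop 5.2.4 p. 1175; Example 5.1.9 p. 1174] -/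
theorem ResidualIdentification.of_kernel_of_transvection
    (hSpA : (residual ρA.toMonoidHom).range ≤ iotaGL.range) (hK : KernelIdentification N a b ρA)
    {c : absoluteGaloisGroup ℚ} (hc5 : residual ρA.toMonoidHom c ^ 5 = 1)
    (hc1 : residual ρA.toMonoidHom c ≠ 1)
    (hi : ∃ v : HeightOneSpectrum (𝓞 ℚ), ((N : ℕ) : 𝓞 ℚ) ∈ v.asIdeal ∧ ∃ 𝔓 ∈ v.primesAbove,
      ∃ τ ∈ 𝔓.inertia (absoluteGaloisGroup ℚ),
        IsTransvection ((residual ρA.toMonoidHom τ : GL (Fin 4) (ZMod 2)) :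
          Matrix (Fin 4) (Fin 4) (ZMod 2))) :
    ResidualIdentification N a b ρA := by
  intro σ hSp hunr hchar hin
  have hker : ∀ γ, residual ρA.toMonoidHom γ = 1 ↔ σ.toMonoidHom γ = 1 := hK σ hSp hunr hchar hin
  obtain ⟨v, hvN, 𝔓, h𝔓, τ, hτ, hτA⟩ := hi
  have hSpσ : σ.toMonoidHom.range ≤ iotaGL.range := by
    rintro _ ⟨γ, rfl⟩
    exact hSp γ
  have hτσ : IsTransvection ((σ.toMonoidHom τ : GL (Fin 4) (ZMod 2)) :
      Matrix (Fin 4) (Fin 4) (ZMod 2)) := by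
    rcases hin v hvN 𝔓 h𝔓 τ hτ with h1 | hT
    · have hA1 : residual ρA.toMonoidHom τ = 1 := (hker τ).2 h1
      exact (hτA.1 (by rw [hA1, Units.val_one])).elim
    · exact hT
  exact exists_conj_of_ker_iff_of_transvection (residual ρA.toMonoidHom) σ.toMonoidHom hSpA hSpσ hker
    hc5 hc1 hτA hτσ

/-- **Image `S₆`**: the residual identification datum from the kernel identification datum when
`im ρ̄_A = ι(S₆)`, given the Frobenius polynomial of `ρA` at the places over one good odd `q ∤ N` with
`a_q` even, `b_q` odd on the curve side AND on the form side (`(a q, b q)`): `u = Frob_q²` has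
`ρ̄_A(u)` of order `3` and `tr ρ̄_A(u) = tr σ̄(u)` for every admissible `σ̄` (its Frobenius clause at
`q`), and `exists_conj_of_ker_iff_of_trace_orderThree` concludes. [cite: BrumerEtAl2019, Thm 7.3.1 p. 1191; (5.1.8) p. 1174; Thm 7.2.1 (proof) p. 1189] -/
theorem ResidualIdentification.of_kernel_of_range_eq
    (h₁ : (residual ρA.toMonoidHom).range = iotaGL.range) (hK : KernelIdentification N a b ρA)
    {q : ℕ} (hq : q.Prime) (hq2 : q ≠ 2) (hqN : ¬ q ∣ N) {a' c' : ℤ}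
    (hAq : ∀ v : HeightOneSpectrum (𝓞 ℚ), ((q : ℕ) : 𝓞 ℚ) ∈ v.asIdeal →
      ρA.HasFrobCharpolyAt v ((lPolynomialOfSurface q a' c').reverse.map (Int.castRingHom ℤ_[2])))
    (hpar : Even a' ∧ Odd c' ∧ Even (a q) ∧ Odd (b q)) :
    ResidualIdentification N a b ρA := by
  intro σ hSp hunr hchar hin
  have hker : ∀ γ, residual ρA.toMonoidHom γ = 1 ↔ σ.toMonoidHom γ = 1 := hK σ hSp hunr hchar hin
  have hSpσ : σ.toMonoidHom.range ≤ iotaGL.range := by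
    rintro _ ⟨γ, rfl⟩
    exact hSp γ
  obtain ⟨φ, hgA, hgσ⟩ := exists_frob_charpoly_eq_of_parity hq hq2 hAq (hchar q hq hqN hq2) hpar.1
    hpar.2.1 hpar.2.2.1 hpar.2.2.2
  obtain ⟨-, -, -, h3, htr⟩ := GSp4F2.orderSix_datum_of_charpoly hgA hgσ
  have hu3 : residual ρA.toMonoidHom (φ ^ 2) ^ 3 = 1 := by rw [map_pow]; exact h3
  have hu1 : residual ρA.toMonoidHom (φ ^ 2) ≠ 1 := by
    rw [map_pow]; exact (GSp4F2.orderSix_datum_of_charpoly hgA hgσ).2.1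
  have htr' : Matrix.trace ((residual ρA.toMonoidHom (φ ^ 2) : GL (Fin 4) (ZMod 2)) :
        Matrix (Fin 4) (Fin 4) (ZMod 2)) =
      Matrix.trace ((σ.toMonoidHom (φ ^ 2) : GL (Fin 4) (ZMod 2)) : Matrix (Fin 4) (Fin 4) (ZMod 2)) := by
    rw [map_pow, map_pow]; exact htr
  exact exists_conj_of_ker_iff_of_trace_orderThree (residual ρA.toMonoidHom) σ.toMonoidHom h₁ hSpσ hker
    hu3 hu1 htr'

/-- **Image `S₃ ≀ S₂`** (`N = 353`): the residual identification datum from the kernel identification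
datum when `im ρ̄_A` is a conjugate of `ι(S₃ ≀ S₂)`, given the same Frobenius data at one good odd
`q ∤ N` with `a_q` even, `b_q` odd on both sides: `u = Frob_q` has `ρ̄_A(u)⁶ = 1`, `ρ̄_A(u)² ≠ 1`,
`tr ρ̄_A(u) = tr σ̄(u)`, and `exists_conj_of_ker_iff_of_range_S3wrS2` concludes ("the two embeddings of
`S₃ ≀ C₂` differ in the trace of order 3 and 6 elements"). [cite: BrumerEtAl2019, Thm 7.2.1 pp. 1189–1190; (5.1.8) p. 1174] -/
theorem ResidualIdentification.of_kernel_of_range_S3wrS2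
    (h₁ : ∃ g₁ : Perm (Fin 6), (residual ρA.toMonoidHom).range =
      ((Subgroup.closure (Set.range gensS3wrS2)).map (MulAut.conj g₁).toMonoidHom).map iotaGL)
    (hK : KernelIdentification N a b ρA)
    {q : ℕ} (hq : q.Prime) (hq2 : q ≠ 2) (hqN : ¬ q ∣ N) {a' c' : ℤ}
    (hAq : ∀ v : HeightOneSpectrum (𝓞 ℚ), ((q : ℕ) : 𝓞 ℚ) ∈ v.asIdeal →
      ρA.HasFrobCharpolyAt v ((lPolynomialOfSurface q a' c').reverse.map (Int.castRingHom ℤ_[2])))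
    (hpar : Even a' ∧ Odd c' ∧ Even (a q) ∧ Odd (b q)) :
    ResidualIdentification N a b ρA := by
  intro σ hSp hunr hchar hin
  have hker : ∀ γ, residual ρA.toMonoidHom γ = 1 ↔ σ.toMonoidHom γ = 1 := hK σ hSp hunr hchar hin
  have hSpσ : σ.toMonoidHom.range ≤ iotaGL.range := by
    rintro _ ⟨γ, rfl⟩
    exact hSp γ
  obtain ⟨φ, hgA, hgσ⟩ := exists_frob_charpoly_eq_of_parity hq hq2 hAq (hchar q hq hqN hq2) hpar.1
    hpar.2.1 hpar.2.2.1 hpar.2.2.2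
  obtain ⟨h6, h2, htr, -, -⟩ := GSp4F2.orderSix_datum_of_charpoly hgA hgσ
  exact exists_conj_of_ker_iff_of_range_S3wrS2 (residual ρA.toMonoidHom) σ.toMonoidHom h₁ hSpσ hker
    h6 h2 htr

/-- `im ρ̄_A = ι(S₆)` moves along a residual conjugacy `ρ̄_{A'} = ι(π) ρ̄_A ι(π)⁻¹`. [cite: BrumerEtAl2019, §7.3 p. 1191] -/
theorem residual_range_eq_iotaGL_of_conj (h₁ : (residual ρA.toMonoidHom).range = iotaGL.range)
    (π : Perm (Fin 6))
    (hπ : ∀ γ, residual ρA'.toMonoidHom γ = iotaGL π * residual ρA.toMonoidHom γ * (iotaGL π)⁻¹) :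
    (residual ρA'.toMonoidHom).range = iotaGL.range := by
  apply le_antisymm
  · rintro _ ⟨γ, rfl⟩
    rw [hπ γ]
    exact mul_mem (mul_mem ⟨π, rfl⟩ (h₁.le ⟨γ, rfl⟩)) (inv_mem ⟨π, rfl⟩)
  · intro g hg
    have hg' : (iotaGL π)⁻¹ * g * iotaGL π ∈ (residual ρA.toMonoidHom).range := by
      rw [h₁]
      exact mul_mem (mul_mem (inv_mem ⟨π, rfl⟩) hg) ⟨π, rfl⟩
    obtain ⟨γ, hγ⟩ := hg'
    refine ⟨γ, ?_⟩
    rw [hπ γ, hγ]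
    group

end Generic

/-! ## Instances -/

namespace Paramodular277

/-- **`A₂₇₇` paramodular away from `277` with the form side cited and Step 1 (R) in the kernel.**
`paramodular_277_cited` with `hres` DERIVED (`ResidualIdentification.of_kernel_of_transvection`) from:
`hK : KernelIdentification 277 af bf ρA` (part (F) [p. 1188]: "exactly two polynomials of degree 5 … same
Galois closure", the certificate's JR1/JR2 ×2 candidate enumeration + exclusions); `hi` — one inertia element
above `277` at which `ρ̄_A` is a transvection (inertia at `277` in `ℚ(A[2])` is generated by a
transposition: the matching quintic `x⁵ − x⁴ + 2x² − x + 1` [p. 1188] has polynomial discriminant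
`2⁴·277`, so `ord₂₇₇(d) = 1`; `ι(S₅(b))` has transvections [Example 5.1.9 p. 1174]); the element of
order `5` is `Frob₃`, PRODUCED from
`L₃(A₂₇₇) = 1 + T + T² + 3T³ + 9T⁴` (`a₃ = −1` via `h5` and `hf3`, `b₃ = 1` the binder `hb3`; both odd,
`charpoly ρ̄_A(Frob₃) = Φ₅`).  All other binders as in `paramodular_277_cited`.
[cite: BrumerEtAl2019, Thm 7.1.3 p. 1187; Lemma 7.1.4 pp. 1187–1188; (6.2.4) p. 1179; Prop 5.2.4 p. 1175; Example 5.1.9 p. 1174] -/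
theorem paramodular_277_cited_of_kernel
    {A : AbelianVariety ℚ} {f : Matrix (Fin 2) (Fin 2) ℂ → ℂ} {ρA : FramedGaloisRep ℚ ℤ_[2] 4}
    {b : Module.Basis (Fin 4) ℚ_[2] (A.rationalTateModule 2)}
    (h438 : BrumerEtAl2019.existsIntegralSymplecticGaloisRep_two_primeLevel)
    (G : GaloisCertificate277 ρA)
    (hframe : A.IsFrameOfTateRep 2 b (rationalize ρA)) (aA bA af bf : ℕ → ℤ)
    (hK : KernelIdentification 277 af bf ρA)
    (hi : ∃ v : HeightOneSpectrum (𝓞 ℚ), ((277 : ℕ) : 𝓞 ℚ) ∈ v.asIdeal ∧ ∃ 𝔓 ∈ v.primesAbove,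
      ∃ τ ∈ 𝔓.inertia (absoluteGaloisGroup ℚ),
        IsTransvection ((residual ρA.toMonoidHom τ : GL (Fin 4) (ZMod 2)) :
          Matrix (Fin 4) (Fin 4) (ZMod 2)))
    (hA : ∀ p : ℕ, p.Prime → ¬ p ∣ 277 →
      A.HasGoodEulerFactorAt p ((lPolynomialOfSurface p (aA p) (bA p)).map (Int.castRingHom ℚ)))
    (hb3 : bA 3 = 1)
    (h5 : ∀ p ∈ data277.checkPrimes.toFinset, aA p = af p)
    (hcusp : IsParamodularCuspForm 277 2 f) (hne : ∃ Z ∈ siegelUpperHalfSpace 2, f Z ≠ 0)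
    (hfe : ∀ p : ℕ, p.Prime → ¬ p ∣ 277 →
      HasSpinorEulerFactorAt 2 p f ((lPolynomialOfSurface p (af p) (bf p)).map (Int.castRingHom ℂ)))
    (hf3 : af 3 = -1 ∧ bf 3 = 1) (h2 : aA 2 = af 2 ∧ bA 2 = bf 2) :
    IsParamodularAwayFrom A 277 f := by
  have G' : GaloisCertificate 277 data277.checkPrimes.toFinset cyclotomicMultiplier ρA := G
  have ha3 : Odd (aA 3) := by rw [h5 3 (by decide), hf3.1]; exact odd_neg_one
  have hb3' : Odd (bA 3) := by rw [hb3]; exact odd_one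
  obtain ⟨c, hc5, hc1⟩ := exists_orderFive_of_eulerData hframe (q := 3) (by norm_num) (by norm_num)
    (hA 3 (by norm_num) (by norm_num)) ha3 hb3'
  exact paramodular_277_cited h438 G hframe aA bA af bf
    (ResidualIdentification.of_kernel_of_transvection
      (range_residual_le_iotaGL_framed ρA cyclotomicMultiplier G'.similitude) hK hc5 hc1 hi)
    hA h5 hcusp hne hfe hf3 h2

end Paramodular277

namespace Paramodular349

/-- **`A₃₄₉` paramodular away from `349` (NOT a printed theorem — the method of [BPPTVY] applied to
`(A₃₄₉, f₃₄₉)`, see `ParamodularCitedInstances.lean`) with the form side cited and Step 1 (R) in the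
kernel.**  `paramodular_349_cited` with `hres` DERIVED by Route T from `hK : KernelIdentification 349 af bf ρA`,
`hi` (a transvection in `ρ̄_A` of inertia above `349`), and `Frob₃` of order `5` PRODUCED from
`L₃(A₃₄₉) = 1 + T − T² + 3T³ + 9T⁴` (`(a₃, b₃) = (−1, −1)` odd/odd: `a₃` via `h5`/`hf3`, `b₃` the binder
`hb3`). [cite: BrumerEtAl2019, Alg 2.4.1 p. 1155; Lemma 7.1.4 pp. 1187–1188 (method); (5.1.8) p. 1174; Prop 5.2.4 p. 1175] -/
theorem paramodular_349_cited_of_kernel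
    {A : AbelianVariety ℚ} {f : Matrix (Fin 2) (Fin 2) ℂ → ℂ} {ρA : FramedGaloisRep ℚ ℤ_[2] 4}
    {b : Module.Basis (Fin 4) ℚ_[2] (A.rationalTateModule 2)}
    (h438 : BrumerEtAl2019.existsIntegralSymplecticGaloisRep_two_primeLevel)
    (G : GaloisCertificate349 ρA)
    (hframe : A.IsFrameOfTateRep 2 b (rationalize ρA)) (aA bA af bf : ℕ → ℤ)
    (hK : KernelIdentification 349 af bf ρA)
    (hi : ∃ v : HeightOneSpectrum (𝓞 ℚ), ((349 : ℕ) : 𝓞 ℚ) ∈ v.asIdeal ∧ ∃ 𝔓 ∈ v.primesAbove,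
      ∃ τ ∈ 𝔓.inertia (absoluteGaloisGroup ℚ),
        IsTransvection ((residual ρA.toMonoidHom τ : GL (Fin 4) (ZMod 2)) :
          Matrix (Fin 4) (Fin 4) (ZMod 2)))
    (hA : ∀ p : ℕ, p.Prime → ¬ p ∣ 349 →
      A.HasGoodEulerFactorAt p ((lPolynomialOfSurface p (aA p) (bA p)).map (Int.castRingHom ℚ)))
    (hb3 : bA 3 = -1)
    (h5 : ∀ p ∈ checkPrimes349, aA p = af p)
    (hcusp : IsParamodularCuspForm 349 2 f) (hne : ∃ Z ∈ siegelUpperHalfSpace 2, f Z ≠ 0)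
    (hfe : ∀ p : ℕ, p.Prime → ¬ p ∣ 349 →
      HasSpinorEulerFactorAt 2 p f ((lPolynomialOfSurface p (af p) (bf p)).map (Int.castRingHom ℂ)))
    (hf3 : af 3 = -1 ∧ bf 3 = -1) (h2 : aA 2 = af 2 ∧ bA 2 = bf 2) :
    IsParamodularAwayFrom A 349 f := by
  have G' : GaloisCertificate 349 checkPrimes349 cyclotomicMultiplier ρA := G
  have ha3 : Odd (aA 3) := by rw [h5 3 (by decide), hf3.1]; exact odd_neg_one
  have hb3' : Odd (bA 3) := by rw [hb3]; exact odd_neg_one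
  obtain ⟨c, hc5, hc1⟩ := exists_orderFive_of_eulerData hframe (q := 3) (by norm_num) (by norm_num)
    (hA 3 (by norm_num) (by norm_num)) ha3 hb3'
  exact paramodular_349_cited h438 G hframe aA bA af bf
    (ResidualIdentification.of_kernel_of_transvection
      (range_residual_le_iotaGL_framed ρA cyclotomicMultiplier G'.similitude) hK hc5 hc1 hi)
    hA h5 hcusp hne hfe hf3 h2

end Paramodular349

namespace Paramodular353

/-- **`A₃₅₃` paramodular away from `353` with the form side cited and Step 1 (R) in the kernel.**
`paramodular_353_cited` with `hres` DERIVED (`ResidualIdentification.of_kernel_of_range_S3wrS2`) from: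
`hK : KernelIdentification 353 af bf ρA` (part (F): "we find exactly two candidates … so we have the
latter"); `h₁` — `im ρ̄_A` is a conjugate of `ι(S₃ ≀ S₂)` (the `2`-division field has group `S₃ ≀ C₂`);
and `Frob₁₁`, from `L₁₁(A₃₅₃) = Q₁₁(f₃₅₃) = 1 − 2T + T² − 22T³ + 121T⁴` [(7.2.2)]: `a₁₁(A) = 2` via `h5`
and `hf11`, `b₁₁(A) = 1` the binder `hb11`, `(a₁₁, b₁₁)(f) = (2, 1)` the binder `hf11` (even/odd both
sides: an element of order `3` or `6` with equal traces, excluding the other embedding of `S₃ ≀ C₂`).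
[cite: BrumerEtAl2019, Thm 7.2.1 pp. 1189–1190; (7.2.2) p. 1189; (5.1.8) p. 1174; p. 1188] -/
theorem paramodular_353_cited_of_kernel
    {A : AbelianVariety ℚ} {f : Matrix (Fin 2) (Fin 2) ℂ → ℂ} {ρA : FramedGaloisRep ℚ ℤ_[2] 4}
    {b : Module.Basis (Fin 4) ℚ_[2] (A.rationalTateModule 2)}
    (h438 : BrumerEtAl2019.existsIntegralSymplecticGaloisRep_two_primeLevel)
    (G : GaloisCertificate353 ρA)
    (h₁ : ∃ g₁ : Perm (Fin 6), (residual ρA.toMonoidHom).range =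
      ((Subgroup.closure (Set.range gensS3wrS2)).map (MulAut.conj g₁).toMonoidHom).map iotaGL)
    (hframe : A.IsFrameOfTateRep 2 b (rationalize ρA)) (aA bA af bf : ℕ → ℤ)
    (hK : KernelIdentification 353 af bf ρA)
    (hA : ∀ p : ℕ, p.Prime → ¬ p ∣ 353 →
      A.HasGoodEulerFactorAt p ((lPolynomialOfSurface p (aA p) (bA p)).map (Int.castRingHom ℚ)))
    (hb11 : bA 11 = 1)
    (h5 : ∀ p ∈ checkPrimes353, aA p = af p)
    (hcusp : IsParamodularCuspForm 353 2 f) (hne : ∃ Z ∈ siegelUpperHalfSpace 2, f Z ≠ 0)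
    (hfe : ∀ p : ℕ, p.Prime → ¬ p ∣ 353 →
      HasSpinorEulerFactorAt 2 p f ((lPolynomialOfSurface p (af p) (bf p)).map (Int.castRingHom ℂ)))
    (hf3 : af 3 = -2 ∧ bf 3 = 4) (hf11 : af 11 = 2 ∧ bf 11 = 1) (h2 : aA 2 = af 2 ∧ bA 2 = bf 2) :
    IsParamodularAwayFrom A 353 f := by
  have ha11 : Even (aA 11) := by rw [h5 11 (by decide), hf11.1]; exact even_two
  have hb11' : Odd (bA 11) := by rw [hb11]; exact odd_one
  have haf : Even (af 11) := by rw [hf11.1]; exact even_two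
  have hbf : Odd (bf 11) := by rw [hf11.2]; exact odd_one
  exact paramodular_353_cited h438 G hframe aA bA af bf
    (ResidualIdentification.of_kernel_of_range_S3wrS2 h₁ hK (q := 11) (by norm_num) (by norm_num)
      (by norm_num) (hasFrobCharpolyAt_of_eulerData hframe (by norm_num) (hA 11 (by norm_num) (by norm_num)))
      ⟨ha11, hb11', haf, hbf⟩)
    hA h5 hcusp hne hfe hf3 h2

end Paramodular353

namespace Paramodular587plus

/-- **`A⁺₅₈₇` paramodular away from `587` (the plus pair — NOT treated in print, see
`Paramodular587plusCore.lean`) by `S₆` transfer from the Galois half of `A₅₈₇`, with the form side cited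
and Step 1 (R) in the kernel.**  `paramodular_587plus_cited` with `hres` DERIVED
(`ResidualIdentification.of_kernel_of_range_eq`) from `hK : KernelIdentification 587 af bf ρA` alone: the
transfer already PRODUCES `π` with `ρ̄_{A⁺} = ι(π) ρ̄_{A₅₈₇} ι(π)⁻¹` from `#im ρ̄_{A₅₈₇} = 720`, the common
kernel and `L₃` of both curves (`exists_residual_conj_of_eulerData`), hence `im ρ̄_{A⁺} = ι(S₆)`
(`residual_range_eq_iotaGL_of_conj`), and `Frob₃²` (`L₃(A⁺) = Q₃(f⁺) = 1 + T² + 9T⁴`, `(0, 1)` even/odd)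
is the order-`3` element with equal traces. [cite: BrumerEtAl2019, Thm 7.3.1 p. 1191 (method, minus pair); (5.1.8) p. 1174; Alg 2.4.1 p. 1155; p. 1188] -/
theorem paramodular_587plus_cited_of_kernel
    {ν₀ : absoluteGaloisGroup ℚ → ℤ_[2]} {ρ₀ ρA : FramedGaloisRep ℚ ℤ_[2] 4}
    {A₀ A : AbelianVariety ℚ} {b₀ : Module.Basis (Fin 4) ℚ_[2] (A₀.rationalTateModule 2)}
    {b : Module.Basis (Fin 4) ℚ_[2] (A.rationalTateModule 2)} {f : Matrix (Fin 2) (Fin 2) ℂ → ℂ}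
    (h438 : BrumerEtAl2019.existsIntegralSymplecticGaloisRep_two_primeLevel)
    (hG : GaloisCertificate587 ν₀ ρ₀)
    (hcard : Nat.card (residual ρ₀.toMonoidHom).range = 720)
    (hframe₀ : A₀.IsFrameOfTateRep 2 b₀ (rationalize ρ₀)) {a₃ b₃ : ℤ}
    (hA₃ : A₀.HasGoodEulerFactorAt 3 ((lPolynomialOfSurface 3 a₃ b₃).map (Int.castRingHom ℚ)))
    (h₃ : Even a₃ ∧ Odd b₃)
    (hker : ∀ γ, residual ρ₀.toMonoidHom γ = 1 ↔ residual ρA.toMonoidHom γ = 1)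
    (hs : ∀ σ, IsSimilitude (antiIdAlt4 ℤ_[2]) (cyclotomicMultiplier σ)
      ((ρA σ : GL (Fin 4) ℤ_[2]) : Matrix (Fin 4) (Fin 4) ℤ_[2]))
    (hframe : A.IsFrameOfTateRep 2 b (rationalize ρA)) (aA bA af bf : ℕ → ℤ)
    (hA : ∀ p : ℕ, p.Prime → ¬ p ∣ 587 →
      A.HasGoodEulerFactorAt p ((lPolynomialOfSurface p (aA p) (bA p)).map (Int.castRingHom ℚ)))
    (h₃' : Even (aA 3) ∧ Odd (bA 3))
    (hK : KernelIdentification 587 af bf ρA)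
    (h5 : ∀ p ∈ checkPrimes587plus, aA p = af p)
    (hcusp : IsParamodularCuspForm 587 2 f) (hne : ∃ Z ∈ siegelUpperHalfSpace 2, f Z ≠ 0)
    (hfe : ∀ p : ℕ, p.Prime → ¬ p ∣ 587 →
      HasSpinorEulerFactorAt 2 p f ((lPolynomialOfSurface p (af p) (bf p)).map (Int.castRingHom ℂ)))
    (hf3 : af 3 = 0 ∧ bf 3 = 1) (h2 : aA 2 = af 2 ∧ bA 2 = bf 2) :
    IsParamodularAwayFrom A 587 f := by
  haveI : Fact (Nat.Prime 587) := ⟨by norm_num⟩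
  have hG' : GaloisCertificate 587 checkPrimes587plus ν₀ ρ₀ := hG
  have h₁ := GSp4F2.residual_range_eq_iotaGL_of_card ρ₀ ν₀ hG'.similitude hcard
  obtain ⟨π, hπ⟩ := exists_residual_conj_of_eulerData h₁ hs hker hframe₀ hframe (q := 3)
    (by norm_num) (by norm_num) hA₃ (hA 3 (by norm_num) (by norm_num)) h₃.1 h₃.2 h₃'.1 h₃'.2
  have haf : Even (af 3) := by rw [hf3.1]; exact ⟨0, rfl⟩
  have hbf : Odd (bf 3) := by rw [hf3.2]; exact odd_one
  have hres : ResidualIdentification 587 af bf ρA :=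
    ResidualIdentification.of_kernel_of_range_eq (residual_range_eq_iotaGL_of_conj h₁ π hπ) hK
      (q := 3) (by norm_num) (by norm_num) (by norm_num)
      (hasFrobCharpolyAt_of_eulerData hframe (by norm_num) (hA 3 (by norm_num) (by norm_num)))
      ⟨h₃'.1, h₃'.2, haf, hbf⟩
  exact paramodular_of_galoisCertificate_cited (by norm_num) h438 (hG'.ofResidualConj π hπ hs) hframe
    aA bA af bf hres hA checkPrimes587plus_good h5 hcusp hne hfe (typeG_587plus_at_three af bf hf3) h2

end Paramodular587plus

end Literature.NumberTheory.FaltingsSerre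

end
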